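import Summits.AtomisticToContinuum.HydrodynamicLimit.Theorems.AntiMazurCoboundariesInfluenceLocalityTrueCapsExistPrelimB

/-!
# Prelim F of stub `stub_trueCapsExist` (line `true-anchored-infection`, crux `InfluenceLocality`,
# stmt-AtomisticToContinuum-13916; route AntiMazurCoboundaries): the Gaussian flux integrals decay
# like the Maxwellian tail

The collision-flux bounds of STUB 4 (`trueCaps_rice_self`, `trueCaps_rice_other`) and its time-`0`
term produce three Gaussian integrals weighted by the fast event `{u < ‖v_j - c‖}`:
`I_fast = TrueCaps.fastFlux`, `J₃ = TrueCaps.nearFlux`, `J₁ = TrueCaps.ballFlux` (Prelim B). Here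
they are bounded by the tail factor `TrueCaps.tailC θ u = 2^{3/2} e^{-u²/(4θ)}` times polynomial
moments `TrueCaps.Kmom` of the Gaussian (finite constants independent of the cap `u`, of the range
`R` and of `N`) and, for `J₁, J₃`, the cube of an affine function of the radius parameters:

* `TrueCaps.fastFlux_le` — `I_fast ≤ tailC · K₁(2θ) K₁(θ)` (`‖w - v‖ ≤ (1 + ‖v - c‖)(1 + ‖w - c‖)`,
  Tonelli, `trueCaps_gauss_tail`);
* `TrueCaps.ballFlux_le` — `J₁ ≤ tailC · (ρ + Vτ + τ‖c‖ + τ)³ · K₃(2θ)`;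
* `trueCaps_nearFlux_le` (registered prelim) —
  `J₃ ≤ tailC · (ρ + Vτ + 3τ‖c‖ + 3τ)³ · K₄(2θ) K₁(θ) K₃(θ)`.
-/

namespace Summit.AtomisticToContinuum.HydrodynamicLimit.Theorems.TrueAnchoredInfection

open MeasureTheory Set Filter Topology Real
open scoped ENNReal
open Literature.Analysis.FluidPDE Literature.MathematicalPhysics.KineticTheory

noncomputable section

namespace TrueCaps

/-- `‖w - v‖ ≤ (1 + ‖v - c‖) (1 + ‖w - c‖)`. -/
theorem norm_sub_le_one_add_mul (v w c : V3) : ‖w - v‖ ≤ (1 + ‖v - c‖) * (1 + ‖w - c‖) := by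
  have h1 : ‖w - v‖ ≤ ‖w - c‖ + ‖v - c‖ := by
    calc ‖w - v‖ = ‖(w - c) - (v - c)‖ := by congr 1; abel
      _ ≤ ‖w - c‖ + ‖v - c‖ := norm_sub_le _ _
  nlinarith [norm_nonneg (v - c), norm_nonneg (w - c), mul_nonneg (norm_nonneg (v - c)) (norm_nonneg (w - c))]

/-- The weighted tail moment: `∫ 𝟙{u < ‖v - c‖} (1 + ‖v - c‖)^m dγ_θ ≤ tailC · K_m(2θ)`. -/
theorem lintegral_fast_pow_le {θ u : ℝ} (hθ : 0 < θ) (hu : 0 ≤ u) (c : V3) (m : ℕ) :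
    ∫⁻ v, {v : V3 | u < ‖v - c‖}.indicator 1 v * ENNReal.ofReal ((1 + ‖v - c‖) ^ m) ∂(gaussMeasure c θ) ≤
      ENNReal.ofReal (tailC θ u) * Kmom c (2 * θ) m := by
  have h := trueCaps_gauss_tail θ u c (fun v => ENNReal.ofReal ((1 + ‖v - c‖) ^ m)) hθ hu (measurable_one_add_norm_pow c m)
  refine le_trans (le_of_eq (lintegral_congr fun v => ?_)) h
  by_cases hv : v ∈ {v : V3 | u < ‖v - c‖}
  · rw [indicator_of_mem hv, indicator_of_mem hv, Pi.one_apply, one_mul]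
  · rw [indicator_of_notMem hv, indicator_of_notMem hv, zero_mul]

/-- **`I_fast ≤ tailC · K₁(2θ) K₁(θ)`.** -/
theorem fastFlux_le {θ u : ℝ} (hθ : 0 < θ) (hu : 0 ≤ u) (c : V3) :
    fastFlux c θ u ≤ ENNReal.ofReal (tailC θ u) * Kmom c (2 * θ) 1 * Kmom c θ 1 := by
  set f : V3 → ℝ≥0∞ := fun v => {v : V3 | u < ‖v - c‖}.indicator 1 v * ENNReal.ofReal ((1 + ‖v - c‖) ^ 1) with hf
  set g : V3 → ℝ≥0∞ := fun w => ENNReal.ofReal ((1 + ‖w - c‖) ^ 1) with hg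
  have hfm : Measurable f := (measurable_one.indicator
    (measurableSet_lt measurable_const (measurable_id.sub measurable_const).norm)).mul (measurable_one_add_norm_pow c 1)
  have hgm : Measurable g := measurable_one_add_norm_pow c 1
  have hle : ∀ p : V3 × V3, ENNReal.ofReal ‖p.2 - p.1‖ * {p : V3 × V3 | u < ‖p.1 - c‖}.indicator 1 p ≤ f p.1 * g p.2 := by
    intro p
    by_cases hp : u < ‖p.1 - c‖
    · have hp1 : p ∈ {p : V3 × V3 | u < ‖p.1 - c‖} := hp
      have hp2 : p.1 ∈ {v : V3 | u < ‖v - c‖} := hp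
      rw [indicator_of_mem hp1, hf, hg]
      simp only [indicator_of_mem hp2, Pi.one_apply, mul_one, one_mul, pow_one]
      rw [← ENNReal.ofReal_mul (by positivity)]
      exact ENNReal.ofReal_le_ofReal (norm_sub_le_one_add_mul p.1 p.2 c)
    · have hp1 : p ∉ {p : V3 × V3 | u < ‖p.1 - c‖} := hp
      rw [indicator_of_notMem hp1, mul_zero]
      exact bot_le
  calc fastFlux c θ u ≤ ∫⁻ p, f p.1 * g p.2 ∂((gaussMeasure c θ).prod (gaussMeasure c θ)) := lintegral_mono hle
    _ = (∫⁻ v, f v ∂(gaussMeasure c θ)) * ∫⁻ w, g w ∂(gaussMeasure c θ) :=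
        lintegral_prod_mul hfm.aemeasurable hgm.aemeasurable
    _ ≤ (ENNReal.ofReal (tailC θ u) * Kmom c (2 * θ) 1) * Kmom c θ 1 := by
        gcongr
        · exact lintegral_fast_pow_le hθ hu c 1
        · exact le_of_eq rfl

/-- `ρ + (‖v‖ + V) τ ≤ (ρ + Vτ + τ‖c‖ + τ) (1 + ‖v - c‖)` for nonnegative parameters. -/
theorem ballRadius_le {ρ V τ : ℝ} (hρ : 0 ≤ ρ) (hV : 0 ≤ V) (hτ : 0 ≤ τ) (c v : V3) :
    ρ + (‖v‖ + V) * τ ≤ (ρ + V * τ + τ * ‖c‖ + τ) * (1 + ‖v - c‖) := by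
  have hv : ‖v‖ ≤ ‖c‖ + ‖v - c‖ := by
    calc ‖v‖ = ‖c + (v - c)‖ := by congr 1; abel
      _ ≤ ‖c‖ + ‖v - c‖ := norm_add_le _ _
  nlinarith [norm_nonneg (v - c), norm_nonneg c, mul_nonneg hτ (norm_nonneg (v - c)),
    mul_nonneg (add_nonneg (add_nonneg hρ (mul_nonneg hV hτ)) (mul_nonneg hτ (norm_nonneg c))) (norm_nonneg (v - c))]

/-- **`J₁ ≤ tailC · (ρ + Vτ + τ‖c‖ + τ)³ · K₃(2θ)`.** -/
theorem ballFlux_le {θ u ρ V τ : ℝ} (hθ : 0 < θ) (hu : 0 ≤ u) (hρ : 0 ≤ ρ) (hV : 0 ≤ V) (hτ : 0 ≤ τ) (c : V3) :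
    ballFlux c θ u ρ V τ ≤ ENNReal.ofReal (tailC θ u) * ENNReal.ofReal ((ρ + V * τ + τ * ‖c‖ + τ) ^ 3) * Kmom c (2 * θ) 3 := by
  set A := ρ + V * τ + τ * ‖c‖ + τ with hA
  have hA0 : 0 ≤ A := by positivity
  have hle : ∀ v : V3, ENNReal.ofReal ((ρ + (‖v‖ + V) * τ) ^ 3) * {v : V3 | u < ‖v - c‖}.indicator 1 v ≤
      ENNReal.ofReal (A ^ 3) * ({v : V3 | u < ‖v - c‖}.indicator 1 v * ENNReal.ofReal ((1 + ‖v - c‖) ^ 3)) := by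
    intro v
    by_cases hv : v ∈ {v : V3 | u < ‖v - c‖}
    · rw [indicator_of_mem hv, Pi.one_apply, mul_one, one_mul, ← ENNReal.ofReal_mul (by positivity), ← mul_pow]
      exact ENNReal.ofReal_le_ofReal (pow_le_pow_left₀ (by positivity) (ballRadius_le hρ hV hτ c v) 3)
    · rw [indicator_of_notMem hv, mul_zero]
      exact bot_le
  have hm : Measurable fun v : V3 => {v : V3 | u < ‖v - c‖}.indicator 1 v * ENNReal.ofReal ((1 + ‖v - c‖) ^ 3) :=
    (measurable_one.indicator (measurableSet_lt measurable_const (measurable_id.sub measurable_const).norm)).mul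
      (measurable_one_add_norm_pow c 3)
  calc ballFlux c θ u ρ V τ
      ≤ ∫⁻ v, ENNReal.ofReal (A ^ 3) * ({v : V3 | u < ‖v - c‖}.indicator 1 v * ENNReal.ofReal ((1 + ‖v - c‖) ^ 3))
          ∂(gaussMeasure c θ) := lintegral_mono hle
    _ = ENNReal.ofReal (A ^ 3) * ∫⁻ v, {v : V3 | u < ‖v - c‖}.indicator 1 v * ENNReal.ofReal ((1 + ‖v - c‖) ^ 3)
          ∂(gaussMeasure c θ) := lintegral_const_mul _ hm
    _ ≤ ENNReal.ofReal (A ^ 3) * (ENNReal.ofReal (tailC θ u) * Kmom c (2 * θ) 3) := by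
        gcongr; exact lintegral_fast_pow_le hθ hu c 3
    _ = _ := by ring

/-- `ρ̃(v_j, v_i) ≤ (ρ + Vτ + 3τ‖c‖ + 3τ) (1 + ‖v_j - c‖) (1 + ‖v_i - c‖)` for nonnegative parameters. -/
theorem nearRadius_le {ρ V τ : ℝ} (hρ : 0 ≤ ρ) (hV : 0 ≤ V) (hτ : 0 ≤ τ) (c vj vi : V3) :
    nearRadius ρ V τ (vj, vi) ≤ (ρ + V * τ + 3 * τ * ‖c‖ + 3 * τ) * ((1 + ‖vj - c‖) * (1 + ‖vi - c‖)) := by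
  have hvj : ‖vj‖ ≤ ‖c‖ + ‖vj - c‖ := by
    calc ‖vj‖ = ‖c + (vj - c)‖ := by congr 1; abel
      _ ≤ ‖c‖ + ‖vj - c‖ := norm_add_le _ _
  have hvi : ‖vi‖ ≤ ‖c‖ + ‖vi - c‖ := by
    calc ‖vi‖ = ‖c + (vi - c)‖ := by congr 1; abel
      _ ≤ ‖c‖ + ‖vi - c‖ := norm_add_le _ _
  simp only [nearRadius]
  set x := ‖vj - c‖ with hx
  set y := ‖vi - c‖ with hy
  have hx0 : 0 ≤ x := norm_nonneg _
  have hy0 : 0 ≤ y := norm_nonneg _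
  set a := ρ + V * τ + 3 * τ * ‖c‖ with ha
  have ha0 : 0 ≤ a := by positivity
  have h1 : ρ + (‖vj‖ + V) * τ + τ * (‖vj‖ + ‖vi‖) ≤ a + 2 * τ * x + τ * y := by
    nlinarith [mul_le_mul_of_nonneg_left hvj hτ, mul_le_mul_of_nonneg_left hvi hτ]
  refine h1.trans ?_
  nlinarith [mul_nonneg hx0 hy0, mul_nonneg ha0 hx0, mul_nonneg ha0 hy0, mul_nonneg ha0 (mul_nonneg hx0 hy0),
    mul_nonneg hτ hx0, mul_nonneg hτ hy0, mul_nonneg hτ (mul_nonneg hx0 hy0)]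

end TrueCaps

open TrueCaps in
/-- **Registered prelim `trueCaps_nearFlux_le`** (of `stub_trueCapsExist`): the three-velocity flux
integral of the localised window bound decays like the Maxwellian tail,
`J₃ ≤ 2^{3/2} e^{-u²/(4θ)} · (ρ + Vτ + 3τ‖c‖ + 3τ)³ · K₄(2θ) K₁(θ) K₃(θ)` for `θ > 0`, `u, ρ, V, τ ≥ 0`
(`‖v_k - v_j‖ ≤ (1 + ‖v_j - c‖)(1 + ‖v_k - c‖)`, `TrueCaps.nearRadius_le`, Tonelli twice, and the
tail lemma `trueCaps_gauss_tail` in the variable `v_j`). -/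
theorem trueCaps_nearFlux_le : ∀ (θ u ρ V τ : ℝ) (c : V3), 0 < θ → 0 ≤ u → 0 ≤ ρ → 0 ≤ V → 0 ≤ τ → TrueCaps.nearFlux c θ u ρ V τ ≤ ENNReal.ofReal (TrueCaps.tailC θ u) * ENNReal.ofReal ((ρ + V * τ + 3 * τ * ‖c‖ + 3 * τ) ^ 3) * TrueCaps.Kmom c (2 * θ) 4 * TrueCaps.Kmom c θ 1 * TrueCaps.Kmom c θ 3 := by
  intro θ u ρ V τ c hθ hu hρ hV hτ
  set A := ρ + V * τ + 3 * τ * ‖c‖ + 3 * τ with hA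
  have hA0 : 0 ≤ A := by positivity
  set S : Set V3 := {v : V3 | u < ‖v - c‖} with hS
  have hSm : MeasurableSet S := measurableSet_lt measurable_const (measurable_id.sub measurable_const).norm
  set f1 : V3 → ℝ≥0∞ := fun v => S.indicator 1 v * ENNReal.ofReal ((1 + ‖v - c‖) ^ 4) with hf1
  set f2 : V3 → ℝ≥0∞ := fun v => ENNReal.ofReal ((1 + ‖v - c‖) ^ 1) with hf2
  set f3 : V3 → ℝ≥0∞ := fun v => ENNReal.ofReal ((1 + ‖v - c‖) ^ 3) with hf3
  have hf1m : Measurable f1 := (measurable_one.indicator hSm).mul (measurable_one_add_norm_pow c 4)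
  have hf2m : Measurable f2 := measurable_one_add_norm_pow c 1
  have hf3m : Measurable f3 := measurable_one_add_norm_pow c 3
  -- the pointwise bound
  have hle : ∀ q : (V3 × V3) × V3,
      ENNReal.ofReal ‖q.1.2 - q.1.1‖ * ENNReal.ofReal (nearRadius ρ V τ (q.1.1, q.2) ^ 3) *
          {q : (V3 × V3) × V3 | u < ‖q.1.1 - c‖}.indicator 1 q ≤
        ENNReal.ofReal (A ^ 3) * ((f1 q.1.1 * f2 q.1.2) * f3 q.2) := by
    intro q
    by_cases hq : u < ‖q.1.1 - c‖
    · have hq1 : q ∈ {q : (V3 × V3) × V3 | u < ‖q.1.1 - c‖} := hq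
      have hq2 : q.1.1 ∈ S := hq
      rw [indicator_of_mem hq1, hf1, hf2, hf3]
      simp only [indicator_of_mem hq2, Pi.one_apply, mul_one, one_mul, pow_one]
      have hnn : 0 ≤ nearRadius ρ V τ (q.1.1, q.2) := nearRadius_nonneg hρ hV hτ _
      rw [← ENNReal.ofReal_mul (norm_nonneg _), ← ENNReal.ofReal_mul (by positivity), ← ENNReal.ofReal_mul (by positivity),
        ← ENNReal.ofReal_mul (by positivity)]
      refine ENNReal.ofReal_le_ofReal ?_
      have h1 := norm_sub_le_one_add_mul q.1.1 q.1.2 c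
      have h2 : nearRadius ρ V τ (q.1.1, q.2) ^ 3 ≤ (A * ((1 + ‖q.1.1 - c‖) * (1 + ‖q.2 - c‖))) ^ 3 :=
        pow_le_pow_left₀ hnn (nearRadius_le hρ hV hτ c q.1.1 q.2) 3
      calc ‖q.1.2 - q.1.1‖ * nearRadius ρ V τ (q.1.1, q.2) ^ 3
          ≤ ((1 + ‖q.1.1 - c‖) * (1 + ‖q.1.2 - c‖)) * (A * ((1 + ‖q.1.1 - c‖) * (1 + ‖q.2 - c‖))) ^ 3 :=
            mul_le_mul h1 h2 (pow_nonneg hnn 3) (by positivity)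
        _ = A ^ 3 * ((1 + ‖q.1.1 - c‖) ^ 4 * (1 + ‖q.1.2 - c‖) * (1 + ‖q.2 - c‖) ^ 3) := by ring
    · have hq1 : q ∉ {q : (V3 × V3) × V3 | u < ‖q.1.1 - c‖} := hq
      rw [indicator_of_notMem hq1, mul_zero]
      exact bot_le
  have h12m : Measurable fun p : V3 × V3 => f1 p.1 * f2 p.2 := (hf1m.comp measurable_fst).mul (hf2m.comp measurable_snd)
  calc nearFlux c θ u ρ V τ
      ≤ ∫⁻ q, ENNReal.ofReal (A ^ 3) * ((f1 q.1.1 * f2 q.1.2) * f3 q.2)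
          ∂(((gaussMeasure c θ).prod (gaussMeasure c θ)).prod (gaussMeasure c θ)) := lintegral_mono hle
    _ = ENNReal.ofReal (A ^ 3) * ∫⁻ q, (f1 q.1.1 * f2 q.1.2) * f3 q.2
          ∂(((gaussMeasure c θ).prod (gaussMeasure c θ)).prod (gaussMeasure c θ)) :=
        lintegral_const_mul _ ((h12m.comp measurable_fst).mul (hf3m.comp measurable_snd))
    _ = ENNReal.ofReal (A ^ 3) * ((∫⁻ p, f1 p.1 * f2 p.2 ∂((gaussMeasure c θ).prod (gaussMeasure c θ))) *
          ∫⁻ v, f3 v ∂(gaussMeasure c θ)) := by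
        rw [lintegral_prod_mul h12m.aemeasurable hf3m.aemeasurable]
    _ = ENNReal.ofReal (A ^ 3) * (((∫⁻ v, f1 v ∂(gaussMeasure c θ)) * ∫⁻ v, f2 v ∂(gaussMeasure c θ)) *
          ∫⁻ v, f3 v ∂(gaussMeasure c θ)) := by
        rw [lintegral_prod_mul hf1m.aemeasurable hf2m.aemeasurable]
    _ ≤ ENNReal.ofReal (A ^ 3) * (((ENNReal.ofReal (tailC θ u) * Kmom c (2 * θ) 4) * Kmom c θ 1) * Kmom c θ 3) := by
        gcongr
        · exact lintegral_fast_pow_le hθ hu c 4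
        · exact le_of_eq rfl
        · exact le_of_eq rfl
    _ = _ := by ring

end

end Summit.AtomisticToContinuum.HydrodynamicLimit.Theorems.TrueAnchoredInfection
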